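import Literature.NumberTheory.LFunctions.DworkRationalitySplittingValues
import Literature.NumberTheory.LFunctions.DworkRationalityTeichmuller
import Mathlib.FieldTheory.Perfect
import HarnessLib

/-!
# Dwork's `p`-adic lifting of the character sum: proof of `Dwork.dworkLifting`

Discharge of the named fact `Literature.NumberTheory.LFunctions.Dwork.dworkLifting`
(`…/DworkRationalityMeromorphy.lean`), the last analytic input of Dwork's rationality theorem
(Koblitz, GTM 58, Ch. V §2 and §4 pp. 132–133; Dwork, Amer. J. Math. 82 (1960), §4; Lang,
*Cyclotomic Fields I and II*, Ch. 14 §3), from the sibling files: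

* `…/DworkRationalitySplittingSeries.lean`, `…/DworkRationalitySplittingValues.lean`: Dwork's
  power series `θ = exp(π(X - Xᵖ))`, `π^{p-1} = -p`, is overconvergent, `ε = θ(1)` satisfies `εᵖ = 1`,
  `ε ≠ 1`, and the splitting identity `∏_{i<M} θ(z^{pⁱ}) = εⁿ` for Teichmüller `z` and
  `n ≡ ∑_{i<M} z^{pⁱ} (mod 𝔪)`;
* `…/DworkRationalityTeichmuller.lean`: Teichmüller representatives `T : k̄ →* ℂ_p` and the trace
  congruence `∑_{i<rs} (T y)^{pⁱ} ≡ Tr_{𝔽_{qˢ}/𝔽_p}(y)`.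

Given `f = ∑_u a_u X^u ∈ k[x_σ]`, `q = pʳ`, the overconvergent series is Koblitz's
`G = ∏_u ∏_{j<r} θ(A_u^{pʲ} X^{pʲ w(u)})` with `A_u = T(a_u)` and `w(u) = (1, u)` the exponent of
`X₀ X^u` (Koblitz, Ch. V §4, p. 132); the Teichmüller map of `𝔽_{qˢ}` is `T|_{𝔽_{qˢ}}` and the
additive character is `ψ(y) = ε^{Tr(y)}` (`AddChar.zmodChar` composed with `Algebra.trace`). The
identity `∏_{l<s} G(t^{qˡ}) = ψ(x₀ f(x))` (p. 133) follows factor by factor from the splitting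
identity applied to `z_u = T(a_u x^{w(u)})`, and the orthogonality relation from the surjectivity of
the trace (`Algebra.trace_surjective`) and `ε ≠ 1`.

## References

* N. Koblitz, *p-adic Numbers, p-adic Analysis, and Zeta-Functions*, GTM 58 (1984), Ch. V §2,
  §4 pp. 132–133. [Koblitz1984]
* B. Dwork, *On the rationality of the zeta function of an algebraic variety*, Amer. J. Math. 82
  (1960), 631–648, §4. [Dwork1960]
* S. Lang, *Cyclotomic Fields I and II*, GTM 121 (1990), Ch. 14 §3, Thm. 3.3. [Lang1990]
-/

open PowerSeries Finset

noncomputable section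

universe u

namespace Literature.NumberTheory.LFunctions

namespace Dwork

variable {p : ℕ} [Fact p.Prime]

/-! ### Substituting a monomial into a one-variable series: `θ(c X^v)` -/

section Monomial

variable {ι : Type*}

/-- `d ↦ d • v` is injective for `v ≠ 0`. [folklore] -/
theorem nsmul_left_injective_of_ne_zero {v : ι →₀ ℕ} (hv : v ≠ 0) :
    Function.Injective fun d : ℕ => d • v := by
  obtain ⟨i, hi⟩ : ∃ i, v i ≠ 0 := by
    by_contra h
    push Not at h
    exact hv (Finsupp.ext h)
  intro d d' h
  have := congrArg (fun w : ι →₀ ℕ => w i) h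
  simp only [Finsupp.smul_apply, smul_eq_mul] at this
  exact Nat.eq_of_mul_eq_mul_right (Nat.pos_of_ne_zero hi) this

/-- **Coefficients of `θ(cX^v)`**: the coefficient of `X^{d•v}` is `θ_d cᵈ`. [folklore] -/
theorem coeff_subst_monomial_smul (θ : ℂ_[p]⟦X⟧) {v : ι →₀ ℕ} (hv : v ≠ 0) (c : ℂ_[p]) (d : ℕ) :
    MvPowerSeries.coeff (d • v) (θ.subst (MvPowerSeries.monomial v c)) = coeff d θ * c ^ d := by
  classical
  rw [PowerSeries.coeff_subst (PowerSeries.HasSubst.monomial hv c), finsum_eq_single _ d]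
  · rw [MvPowerSeries.monomial_pow, MvPowerSeries.coeff_monomial, if_pos rfl, smul_eq_mul]
  · intro d' hd'
    rw [MvPowerSeries.monomial_pow, MvPowerSeries.coeff_monomial, if_neg, smul_zero]
    exact fun h => hd' (nsmul_left_injective_of_ne_zero hv h).symm

/-- The other coefficients of `θ(cX^v)` vanish. [folklore] -/
theorem coeff_subst_monomial_eq_zero (θ : ℂ_[p]⟦X⟧) {v : ι →₀ ℕ} (hv : v ≠ 0) (c : ℂ_[p])
    {m : ι →₀ ℕ} (hm : ∀ d : ℕ, m ≠ d • v) :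
    MvPowerSeries.coeff m (θ.subst (MvPowerSeries.monomial v c)) = 0 := by
  classical
  rw [PowerSeries.coeff_subst (PowerSeries.HasSubst.monomial hv c)]
  refine finsum_eq_zero_of_forall_eq_zero fun d => ?_
  rw [MvPowerSeries.monomial_pow, MvPowerSeries.coeff_monomial, if_neg (hm d), smul_zero]

/-- **`θ(cX^v) ∈ R₀`** for `θ ∈ R₀`, `‖c‖ ≤ 1`, `v ≠ 0` (Koblitz, Ch. V §3 Ex. 2 / §4 p. 132: the
factors `Θ(a X^w)` of `G` lie in `R₀`), with radius parameter `ρ^{1/|v|}`. [cite: Koblitz1984, Ch. V §4] -/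
theorem IsOverconvergent.subst_monomial {θ : ℂ_[p]⟦X⟧} (hθ : IsOverconvergent p θ) {v : ι →₀ ℕ}
    (hv : v ≠ 0) {c : ℂ_[p]} (hc : ‖c‖ ≤ 1) :
    IsOverconvergent p (θ.subst (MvPowerSeries.monomial v c)) := by
  classical
  obtain ⟨ρ, hρ0, hρ1, hρ⟩ := hθ
  set N : ℕ := Finsupp.degree v with hNdef
  have hN : N ≠ 0 := fun h => hv ((Finsupp.degree_eq_zero_iff v).mp h)
  refine ⟨ρ ^ ((N : ℝ)⁻¹), Real.rpow_nonneg hρ0 _,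
    Real.rpow_lt_one hρ0 hρ1 (inv_pos.mpr (by exact_mod_cast Nat.pos_of_ne_zero hN)), fun m => ?_⟩
  by_cases h : ∃ d : ℕ, m = d • v
  · obtain ⟨d, rfl⟩ := h
    rw [coeff_subst_monomial_smul θ hv c d, norm_mul, norm_pow, map_nsmul, smul_eq_mul, ← hNdef,
      mul_comm d, pow_mul, Real.rpow_inv_natCast_pow hρ0 hN]
    have hd : ‖coeff d θ‖ ≤ ρ ^ d := by
      have := hρ (Finsupp.single () d)
      rwa [Finsupp.degree_single] at this
    exact (mul_le_of_le_one_right (norm_nonneg _) (pow_le_one₀ (norm_nonneg _) hc)).trans hd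
  · push Not at h
    rw [coeff_subst_monomial_eq_zero θ hv c h, norm_zero]
    exact pow_nonneg (Real.rpow_nonneg hρ0 _) _

/-- `x^{m•u} = (x^u)^m`. [folklore] -/
theorem monomialAt_smul_eq_pow (x : ι → ℂ_[p]) (m : ℕ) (u : ι →₀ ℕ) :
    monomialAt x (m • u) = monomialAt x u ^ m := by
  classical
  rcases Nat.eq_zero_or_pos m with rfl | hm
  · simp [monomialAt]
  · rw [monomialAt, monomialAt, Finsupp.prod, Finsupp.prod, Finsupp.support_smul_eq hm.ne',
      ← Finset.prod_pow]
    exact Finset.prod_congr rfl fun i _ => by rw [Finsupp.smul_apply, smul_eq_mul, mul_comm, pow_mul]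

/-- **`θ(cX^v)` at a point**: `θ(cX^v)(t) = θ(c t^v)` on the unit polydisc (reindex the sum along
`d ↦ d • v`). [cite: Koblitz1984, Ch. V §4] -/
theorem evalAt_subst_monomial (θ : ℂ_[p]⟦X⟧) {v : ι →₀ ℕ} (hv : v ≠ 0) (c : ℂ_[p]) (t : ι → ℂ_[p]) :
    evalAt p (θ.subst (MvPowerSeries.monomial v c)) t = evalOne p θ (c * monomialAt t v) := by
  classical
  rw [evalAt, evalOne, ← (nsmul_left_injective_of_ne_zero hv).tsum_eq]
  · refine tsum_congr fun d => ?_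
    change MvPowerSeries.coeff (d • v) _ * monomialAt t (d • v) = _
    rw [coeff_subst_monomial_smul θ hv c d, monomialAt_smul_eq_pow, mul_pow]
    ring
  · intro m hm
    rw [Function.mem_support] at hm
    by_contra h
    apply hm
    change MvPowerSeries.coeff m _ * monomialAt t m = 0
    rw [coeff_subst_monomial_eq_zero θ hv c (fun d hd => h ⟨d, hd.symm⟩), zero_mul]

end Monomial

/-! ### Small combinatorial helpers -/

/-- `∏_{l<s} ∏_{j<r} f(rl + j) = ∏_{i<rs} f(i)`. [folklore] -/
theorem prod_range_mul_eq {M : Type*} [CommMonoid M] (f : ℕ → M) (r s : ℕ) :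
    ∏ l ∈ range s, ∏ j ∈ range r, f (r * l + j) = ∏ i ∈ range (r * s), f i := by
  induction s with
  | zero => rw [prod_range_zero, mul_zero, prod_range_zero]
  | succ s ih => rw [prod_range_succ, ih, Nat.mul_succ, prod_range_add]

/-- An additive character turns finite sums into products. [folklore] -/
theorem AddChar.map_finset_sum {A M : Type*} [AddCommMonoid A] [CommMonoid M] (ψ : AddChar A M)
    {α : Type*} (t : Finset α) (g : α → A) : ψ (∑ a ∈ t, g a) = ∏ a ∈ t, ψ (g a) := by
  classical
  induction t using Finset.induction_on with
  | empty => rw [sum_empty, prod_empty, AddChar.map_zero_eq_one]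
  | insert a t ha ih => rw [sum_insert ha, prod_insert ha, AddChar.map_add_eq_mul, ih]

/-- The exponent `w(u) = X₀ X^u` of a monomial of `X₀ f`: `1` at `X₀ = X_{none}`, `u` on `σ`. [cite: Koblitz1984, Ch. V §4] -/
theorem liftExp_spec {σ : Type*} (u : σ →₀ ℕ) :
    (Finsupp.single none 1 + u.mapDomain some : Option σ →₀ ℕ) none = 1 ∧
      ∀ j, (Finsupp.single none 1 + u.mapDomain some : Option σ →₀ ℕ) (some j) = u j := by
  constructor
  · rw [Finsupp.add_apply, Finsupp.single_eq_same, Finsupp.mapDomain_notin_range, add_zero]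
    rintro ⟨j, hj⟩; exact Option.some_ne_none j hj
  · intro j
    rw [Finsupp.add_apply, Finsupp.single_eq_of_ne (Option.some_ne_none j), zero_add,
      Finsupp.mapDomain_apply (Option.some_injective σ)]

/-- The monomial `t^{w(u)} = t₀ · ∏ⱼ t_j^{u_j}`. [folklore] -/
theorem monomialAt_liftExp {σ : Type*} (t : Option σ → ℂ_[p]) (u : σ →₀ ℕ) :
    monomialAt t (Finsupp.single none 1 + u.mapDomain some) =
      t none * u.prod fun j n => t (some j) ^ n := by
  rw [monomialAt_add, monomialAt, monomialAt, Finsupp.prod_single_index (h := fun i n => t i ^ n)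
    (pow_zero _), pow_one, Finsupp.prod_mapDomain_index (h := fun i n => t i ^ n) (fun _ => pow_zero _)
    (fun _ _ _ => pow_add _ _ _)]

/-! ### The discharge -/

/-- **Orthogonality of `ψ = ε^{Tr(·)}`**: for an additive character `ψ(y) = ε^{Tr(y)}` of a finite
field `F ⊇ 𝔽_p` with `εᵖ = 1`, `ε ≠ 1`, and `u ≠ 0`, `∑_x ψ(xu) = 0` (shift by `b` with
`Tr(bu) = 1`, which exists since the trace is surjective; Koblitz, Ch. V §4 p. 133, the displayed
orthogonality relation; Lang, Ch. 14 §3). [cite: Koblitz1984, Ch. V §4] -/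
theorem sum_char_mul_eq_zero {F : Type*} [Field F] [Fintype F] [Algebra (ZMod p) F] {ε : ℂ_[p]}
    (hε : ε ^ p = 1) (hε1 : ε ≠ 1) {u : F} (hu : u ≠ 0) :
    ∑ x : F, ((AddChar.zmodChar p hε).compAddMonoidHom
      (Algebra.trace (ZMod p) F).toAddMonoidHom) (x * u) = 0 := by
  have hp : p.Prime := Fact.out
  haveI : Fact (1 < p) := ⟨hp.one_lt⟩
  haveI : Module.Finite (ZMod p) F := Module.Finite.of_finite
  haveI : Algebra.IsAlgebraic (ZMod p) F := Algebra.IsAlgebraic.of_finite (ZMod p) F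
  haveI : Algebra.IsSeparable (ZMod p) F := inferInstance
  set ψ := (AddChar.zmodChar p hε).compAddMonoidHom (Algebra.trace (ZMod p) F).toAddMonoidHom
    with hψ
  have hψ_apply : ∀ y : F, ψ y = ε ^ (Algebra.trace (ZMod p) F y).val := fun y => rfl
  -- `b` with `Tr(bu) = 1`
  obtain ⟨b0, hb0⟩ := Algebra.trace_surjective (ZMod p) F 1
  set b := b0 * u⁻¹ with hb
  have hbu : Algebra.trace (ZMod p) F (b * u) = 1 := by
    rw [hb, mul_assoc, inv_mul_cancel₀ hu, mul_one, hb0]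
  have hψb : ψ (b * u) = ε := by rw [hψ_apply, hbu, ZMod.val_one, pow_one]
  -- shift the summation by `b`
  have hshift : ∑ x : F, ψ (x * u) = (∑ x : F, ψ (x * u)) * ψ (b * u) := by
    rw [sum_mul]
    refine (Fintype.sum_equiv (Equiv.addRight b) _ _ fun x => ?_).symm
    rw [Equiv.coe_addRight, add_mul, AddChar.map_add_eq_mul]
  rw [hψb] at hshift
  have h : (∑ x : F, ψ (x * u)) * (1 - ε) = 0 := by rw [mul_sub, mul_one, ← hshift, sub_self]
  rcases mul_eq_zero.mp h with h0 | h0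
  · exact h0
  · exact absurd (sub_eq_zero.mp h0).symm hε1

/-- **Discharge of `Literature.NumberTheory.LFunctions.Dwork.dworkLifting`** (Koblitz, GTM 58,
Ch. V §2 and §4, pp. 132–133; Dwork 1960, §4; Lang, Ch. 14 §3, Thm. 3.3). For `k` finite of
characteristic `p`, `q = pʳ`, and `f = ∑_u a_u X^u ∈ k[x_σ]`: choose `π` with `π^{p-1} = -p`
(`ℂ_p` is algebraically closed), let `θ = exp(π(X - Xᵖ))`, `ε = θ(1)`, and `T : k̄ →* ℂ_p` the
Teichmüller map; put `G = ∏_u ∏_{j<r} θ(T(a_u)^{pʲ} X^{pʲ w(u)})`, `w(u) = X₀X^u` — overconvergent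
as a finite product of members of `R₀`. For `s ≥ 1` take `τ = T|_{𝔽_{qˢ}}` and `ψ = ε^{Tr(·)}`;
then `∏_{l<s} G(τ(x)^{qˡ}) = ∏_u ∏_{i<rs} θ(z_u^{pⁱ})` with `z_u = T(a_u x^{w(u)})`
(`T(a_u)^{qˡ} = T(a_u)`), which by the splitting identity and the trace congruence is
`∏_u ε^{Tr(a_u x^{w(u)})} = ψ(x₀ f(x))`. [cite: Koblitz1984, Ch. V §4 pp. 132–133] [cite: Dwork1960, §4] -/
theorem dworkLifting_holds : dworkLifting.{u} := by
  intro k _ _ p _ _ σ _ f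
  classical
  have hp : p.Prime := Fact.out
  haveI := Fintype.ofFinite k
  -- `q = pʳ`
  obtain ⟨r', _, hcard⟩ := FiniteField.card k p
  set r : ℕ := (r' : ℕ) with hr'
  have hr : Nat.card k = p ^ r := by rw [Nat.card_eq_fintype_card, hcard]
  set q := Nat.card k with hq
  have hq1 : 1 < q := one_lt_natCard
  -- `π`, `θ`, `ε`
  obtain ⟨π, hπ⟩ := IsAlgClosed.exists_pow_nat_eq (-(p : ℂ_[p])) (Nat.sub_pos_of_lt hp.one_lt)
  set θ := splitting p π with hθ
  have hθov : IsOverconvergent p θ := isOverconvergent_splitting hπ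
  set ε := evalOne p θ 1 with hε
  have hεp : ε ^ p = 1 := evalOne_splitting_one_pow hπ
  have hε1 : ε ≠ 1 := evalOne_splitting_one_ne_one hπ
  -- Teichmüller representatives
  obtain ⟨T, hT0, hTnorm, hTinj, hTpow, hTsurj, hTtr⟩ := exists_teichmuller (p := p) k hr
  -- the lifted coefficients `A_u = T(a_u)`, `A_u^q = A_u`
  set A : (σ →₀ ℕ) → ℂ_[p] := fun u => T (algebraMap k (AlgebraicClosure k) (f.coeff u)) with hA
  have hApow : ∀ u (l : ℕ), A u ^ q ^ l = A u := by
    intro u l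
    have h1 : (algebraMap k (AlgebraicClosure k) (f.coeff u)) ^ q ^ 1 =
        algebraMap k (AlgebraicClosure k) (f.coeff u) := by
      rw [pow_one, hq, Nat.card_eq_fintype_card, ← map_pow, FiniteField.pow_card]
    have h := hTpow 1 _ h1
    rw [pow_one] at h
    exact pow_pow_eq_self_of_pow_eq_self h l
  -- the exponents `w(u) = X₀ X^u` and the series `G`
  set w : (σ →₀ ℕ) → (Option σ →₀ ℕ) := fun u => Finsupp.single none 1 + u.mapDomain some with hw
  have hw0 : ∀ u (j : ℕ), p ^ j • w u ≠ 0 := by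
    intro u j h
    have := congrArg (fun v : Option σ →₀ ℕ => v none) h
    have h1 : (w u) none = 1 := (liftExp_spec u).1
    simp only [Finsupp.smul_apply, smul_eq_mul, Finsupp.coe_zero, Pi.zero_apply, h1, mul_one] at this
    exact pow_ne_zero j hp.ne_zero this
  set G : MvPowerSeries (Option σ) ℂ_[p] :=
    ∏ u ∈ f.support, ∏ j ∈ range r,
      θ.subst (MvPowerSeries.monomial (p ^ j • w u) (A u ^ p ^ j)) with hG
  have hfac : ∀ u (j : ℕ), IsOverconvergent p
      (θ.subst (MvPowerSeries.monomial (p ^ j • w u) (A u ^ p ^ j)) :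
        MvPowerSeries (Option σ) ℂ_[p]) := fun u j =>
    hθov.subst_monomial (hw0 u j) (by rw [norm_pow]; exact pow_le_one₀ (norm_nonneg _) (hTnorm _))
  have hGov : IsOverconvergent p G :=
    IsOverconvergent.prod _ fun u _ => IsOverconvergent.prod _ fun j _ => hfac u j
  refine ⟨G, hGov, fun s _ => ?_⟩
  -- now fix `s ≥ 1`
  have hs : 0 < s := Nat.pos_of_ne_zero (NeZero.ne s)
  haveI : CharP (fixedField k s) p :=
    charP_of_injective_algebraMap (algebraMap k (fixedField k s)).injective p
  letI : Algebra (ZMod p) (fixedField k s) := ZMod.algebra _ p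
  -- the Teichmüller map of `𝔽_{qˢ}`
  have hTne : ∀ x : fixedField k s, x ≠ 0 → T x ≠ 0 := by
    intro x hx h
    rw [← hT0] at h
    exact hx (Subtype.ext (hTinj h))
  let τ : fixedField k s →*₀ ℂ_[p] :=
    { toFun := fun x => T x
      map_zero' := by simp only [ZeroMemClass.coe_zero]; exact hT0
      map_one' := by simp only [OneMemClass.coe_one]; exact map_one T
      map_mul' := fun x y => by simp only [MulMemClass.coe_mul]; exact map_mul T _ _ }
  have hτ : ∀ x, τ x = T x := fun x => rfl
  have hτpow : ∀ x : fixedField k s, τ x ^ q ^ s = τ x := fun x => hTpow s _ x.2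
  -- the additive character `ψ = ε^{Tr(·)}`
  let ψ : AddChar (fixedField k s) ℂ_[p] :=
    (AddChar.zmodChar p hεp).compAddMonoidHom (Algebra.trace (ZMod p) (fixedField k s)).toAddMonoidHom
  have hψ : ∀ y, ψ y = ε ^ (Algebra.trace (ZMod p) (fixedField k s) y).val := fun y => rfl
  refine ⟨τ, ψ, ?_, ?_, ?_, fun u hu => sum_char_mul_eq_zero hεp hε1 hu, ?_⟩
  · -- injective
    intro x y hxy
    exact Subtype.ext (hTinj hxy)
  · -- `τ x ^ (qˢ - 1) = 1` for `x ≠ 0`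
    intro x hx
    have hqs : 1 ≤ q ^ s := Nat.one_le_pow _ _ (by omega)
    have h : τ x ^ (q ^ s - 1) * τ x = 1 * τ x := by
      rw [← pow_succ, Nat.sub_add_cancel hqs, hτpow, one_mul]
    exact mul_right_cancel₀ (hTne x hx) h
  · -- surjectivity onto `μ_{qˢ-1}`
    intro y hy
    obtain ⟨x, hx, hxy⟩ := hTsurj s hs y hy
    exact ⟨⟨x, hx⟩, hxy⟩
  · -- the identity `∏_{l<s} G(τ(x)^{qˡ}) = ψ(x₀ f(x))`
    intro x hx
    set t : Option σ → ℂ_[p] := fun i => τ (x i) with ht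
    have htn : ∀ (l : ℕ) (i : Option σ), ‖t i ^ q ^ l‖ ≤ 1 := fun l i => by
      rw [norm_pow]; exact pow_le_one₀ (norm_nonneg _) (hTnorm _)
    -- the elements `y_u ∈ 𝔽_{qˢ}` and `z_u = T(y_u)`
    set yv : (σ →₀ ℕ) → fixedField k s := fun u =>
      x none * (algebraMap k (fixedField k s) (f.coeff u) * u.prod fun j n => x (some j) ^ n) with hyv
    have hz : ∀ u, T (yv u) = A u * monomialAt t (w u) := by
      intro u
      rw [monomialAt_liftExp]
      simp only [hyv, ht, hτ, hA, Finsupp.prod, MulMemClass.coe_mul, SubmonoidClass.coe_finsetProd,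
        SubmonoidClass.coe_pow, map_mul, map_prod, map_pow]
      rw [show ((algebraMap k (fixedField k s) (f.coeff u) : fixedField k s) : AlgebraicClosure k) =
        algebraMap k (AlgebraicClosure k) (f.coeff u) from rfl]
      ring
    -- (4) the splitting identity for each monomial
    have hsplit : ∀ u, ∏ i ∈ range (r * s), evalOne p θ ((A u * monomialAt t (w u)) ^ p ^ i) =
        ε ^ (Algebra.trace (ZMod p) (fixedField k s) (yv u)).val := by
      intro u
      rw [← hz u]
      refine prod_evalOne_splitting_eq_pow hπ (hTnorm _) ?_ (hTtr s (yv u))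
      rw [pow_mul, ← hr]
      exact hTpow s _ (yv u).2
    -- (1)–(3) the factors of `G` at the points `t^{qˡ}`
    have hL : ∀ l ∈ range s, evalAt p G (fun i => t i ^ q ^ l) =
        ∏ u ∈ f.support, ∏ j ∈ range r, evalOne p θ ((A u * monomialAt t (w u)) ^ p ^ (r * l + j)) := by
      intro l _
      rw [hG, evalAt_finset_prod _ (fun u _ => IsOverconvergent.prod _ fun j _ => hfac u j) (htn l)]
      refine prod_congr rfl fun u _ => ?_
      rw [evalAt_finset_prod _ (fun j _ => hfac u j) (htn l)]
      refine prod_congr rfl fun j _ => ?_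
      rw [evalAt_subst_monomial θ (hw0 u j), monomialAt_smul_eq_pow,
        show monomialAt (fun i => t i ^ q ^ l) (w u) = monomialAt t (w u) ^ q ^ l by
          rw [← monomialAt_smul_eq_pow, monomialAt_smul]]
      congr 1
      rw [pow_add, show p ^ (r * l) = q ^ l by rw [hr, pow_mul], pow_mul, mul_pow, hApow u l,
        mul_pow]
    -- (5) the right-hand side
    have haeval : x none * MvPolynomial.aeval (fun j => x (some j)) f = ∑ u ∈ f.support, yv u := by
      have h : MvPolynomial.aeval (fun j => x (some j)) f =
          ∑ u ∈ f.support, algebraMap k (fixedField k s) (f.coeff u) *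
            u.prod fun j n => x (some j) ^ n := by
        conv_lhs => rw [MvPolynomial.as_sum f]
        rw [map_sum]
        exact sum_congr rfl fun u _ => MvPolynomial.aeval_monomial _ _ _
      rw [h, mul_sum]
    rw [prod_congr rfl hL, Finset.prod_comm, haeval, AddChar.map_finset_sum]
    refine prod_congr rfl fun u _ => ?_
    rw [prod_range_mul_eq (fun i => evalOne p θ ((A u * monomialAt t (w u)) ^ p ^ i)) r s, hsplit u,
      hψ]

end Dwork

end Literature.NumberTheory.LFunctions
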